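import Literature.MathematicalPhysics.QuantumFieldTheory.Balaban1983to89.B12RegularSpaces111
import Literature.MathematicalPhysics.QuantumFieldTheory.Balaban1983to89.B12Membership314

/-!
# `Balaban1983to89.B12RegularSpaces111Gauge` — T. Bałaban, *Renormalization group approach to lattice gauge field
theories. I*, Commun. Math. Phys. **109** (1987) 249–301 [Balaban1987RG1]: the conditions (i)–(iv) of the complex regular
spaces `U^c_j(X, α₀, α₁, γ₀)` (pp. 262–263; sibling `B12RegularSpaces111`) ARE INVARIANT under `G`-valued gauge transformations
(1.10) — PROVED, with the same constants — hence so is the set «(𝐔, 𝐉) satisfy (i)–(iii)» of (3.16) p. 273 and (3.29) p. 276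

HONEST FRAMING (cell `lit-balaban`, verbatim): statement-level skeleton of published theorems with citation tags; proofs where landed; nothing here is a claim about the Yang–Mills mass gap.

PDF held: `paper:balaban1987-cmp109-rg-i-small-field` (journal page = PDF page + 248); read from the page renders
`b2b-balaban-ref1/pages/1987-cmp109-rg-I-small-field/…-p014-x2.png` (p. 262), `…-p015-x2.png` (p. 263), `…-p028-x2.png` (p. 276).

WHAT IS REPRODUCED (SKELETON rows `B12.Eq1.19` second sentence, `B12.Eq3.28-3.29` member (3.29), `B12.Eq3.15-3.16` member (3.16);
provable members over the CONCRETE predicates of `B12RegularSpaces111`).  THE PRINT, verbatim.  p. 263: *«We assume that all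
functions 𝐄^{(j)}(X, g_{j−1}, 𝐔, 𝐉) are gauge invariant with respect to the group of all gauge transformations (1.10). … The spaces
U^c_j(X, α₀, α₁) are, by the definition, gauge invariant also. This assumption is an easily verifiable statement for all explicitly
defined terms in the action (1.3). These assumptions imply that the action A_k(U) defined on the space U_k(ε₀), which is contained
in all the spaces U^c_j(X, α₀, α₁), is gauge invariant with respect to all G-valued transformations.»*  p. 276: *«The functions
(3.25), (3.26) are gauge invariant with respect to the simultaneous gauge transformations  𝐔 → 𝐔^u, 𝐉 → R(u)𝐉, B → R(u)B, (3.29)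
for Gᶜ-valued transformations u in a sufficiently small neighborhood of G-valued transformations, so that the configurations after
the transformations belong to proper spaces also.»*  ([Balaban1988Convergent] p. 261 states the same for its multiscale spaces:
*«The spaces defined above are invariant with respect to G-valued gauge transformations.»*)

WHAT IS PROVED (theorems only; nothing is defined).  For a `G`-valued gauge transformation `v` (all sites), under the two STANDING
properties of the matrix model made explicit as hypotheses on `Model` — (N) `‖g‖ ≤ 1` for `g ∈ G` (the operator norm of a unitary
matrix, [Balaban1985Averaging] (19)), so that `X ↦ gXg⁻¹` is an ISOMETRY of `𝔸` (`norm_conj_eq`, from `B8CurlGradHolonomy.norm_conj_le`);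
(Ad) `𝔤ᶜ` is `Ad(G)`-stable — and `G ≤ Gᶜ` where the `Gᶜ`-clause of the pair is concerned:
* §1 lattice/algebra: `gaugeU_one`, `gaugeU_mul` (the `𝐔`-component of (1.10) is an action), **`plaq_gaugeU`**
  (`∂(𝐔^v)(p) = v(x)·∂𝐔(p)·v(x)⁻¹`, [Balaban1985Averaging] (11)), `conj_expI` (`v·exp iξA·v⁻¹ = exp iξ(vAv⁻¹)`, via
  `B12Membership314.exp_units_conj'`), **`nabla_gaugeU_adJ`** (`∇^ξ_{U^v}(R(v)A′) = R(v)∇^ξ_U A′`, [Balaban1985BackgroundPropagators] (3.3));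
* §2 the conditions: `condI_gaugeU` ((1.11) by isometry, (1.12) with the local gauge `u ↦ uv⁻¹` and the SAME `A`), `condII_act`,
  `condIII_act`, `factors_act` (`𝐔^v = (exp iξR(v)A′)·U^v`), `condIV_gaugeU` (under the printed covariance of the data `U_n(M˙(·))`,
  `J_n(M˙(·))` — a property of the constructions of [14, 15], here a hypothesis), **`satisfiesI_III_act`** / `satisfiesI_III_act_iff`,
  `satisfies_act`;
* §3 the spaces: `act_mem_space316_iff` — (3.16) is invariant under `G`-valued gauge transformations ((3.29) for `G`-valued `u`).
NOT here: the «sufficiently small neighborhood of G-valued transformations» part of (3.29) (`Gᶜ`-valued `u` change the constants).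
No `Prop` placeholder, no new fact, no definition; axioms standard.  Unit `lit-balaban-p07` (Phase-2 seat p07 gen 2), HOME
`run/shared/lean/pub/lit-balaban/`.
-/

namespace Literature.MathematicalPhysics.QuantumFieldTheory.Balaban1983to89.B12RegularSpaces111Gauge

open Literature.MathematicalPhysics.QuantumFieldTheory.Balaban1983to89
open Literature.MathematicalPhysics.QuantumFieldTheory.Balaban1983to89.B12RegularSpaces111
open Complex

noncomputable section

/-! ## §1. Lattice and algebra: the action on `𝐔`, plaquette covariance, conjugation of `exp` and of `∇^ξ_U` -/

section Algebra

variable {P : Params} {i : ℕ} {𝔸 : Type*} [Ring 𝔸]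

/-- Lattice translations commute. [folklore] -/
private theorem shift_shift_comm (x : Site P i) (μ ν : Fin P.d) : (x.shift μ).shift ν = (x.shift ν).shift μ := by
  funext κ
  by_cases h1 : κ = ν
  · subst h1
    by_cases h2 : κ = μ
    · subst h2; rfl
    · simp [Site.shift, Function.update_apply, h2]
  · by_cases h2 : κ = μ
    · subst h2; simp [Site.shift, Function.update_apply, h1]
    · simp [Site.shift, Function.update_apply, h1, h2]

/-- `𝐔^1 = 𝐔`. [cite: Balaban1987RG1, (1.10) p.262] -/
theorem gaugeU_one (U : PBond P i → 𝔸ˣ) : gaugeU (1 : Site P i → 𝔸ˣ) U = U := by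
  funext b
  simp [gaugeU]

/-- `𝐔^{wv} = (𝐔^v)^w`. [cite: Balaban1987RG1, (1.10) p.262] -/
theorem gaugeU_mul (w v : Site P i → 𝔸ˣ) (U : PBond P i → 𝔸ˣ) : gaugeU (w * v) U = gaugeU w (gaugeU v U) := by
  funext b
  simp only [gaugeU, Pi.mul_apply, mul_inv_rev, mul_assoc]

/-- **Gauge covariance of the plaquette variables**: `∂(𝐔^v)(p) = v(x) ∂𝐔(p) v(x)⁻¹`, `x` the base point of `p`
([Balaban1985Averaging] (11): «U^u(∂p) = R(u(x))U(∂p)»). [cite: Balaban1987RG1, (1.11) p.262] -/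
theorem plaq_gaugeU (v : Site P i → 𝔸ˣ) (U : PBond P i → 𝔸ˣ) (p : Plaq P i) :
    plaq (gaugeU v U) p = v p.src * plaq U p * (v p.src)⁻¹ := by
  simp only [plaq_eq, gaugeU, PBond.tgt, shift_shift_comm p.src p.ν p.μ, mul_inv_rev, inv_inv, mul_assoc,
    inv_mul_cancel_left]

/-- `R(v)` on `𝐉` composes: `R(wv)𝐉 = R(w)(R(v)𝐉)`. [cite: Balaban1987RG1, (1.10) p.262] -/
theorem adJ_mul (w v : Site P i → 𝔸ˣ) (J : PBond P i → 𝔸) : adJ (w * v) J = adJ w (adJ v J) := by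
  funext b
  simp only [adJ, Pi.mul_apply, Units.val_mul, mul_inv_rev, mul_assoc]

end Algebra

section Normed

variable {P : Params} {i : ℕ} {𝔸 : Type*} [NormedRing 𝔸] [NormedAlgebra ℂ 𝔸] [CompleteSpace 𝔸]
variable {𝓜 : Model 𝔸}

omit [NormedAlgebra ℂ 𝔸] [CompleteSpace 𝔸] in
/-- Conjugation by an element of `G` is an isometry of `𝔸` when `‖g‖ ≤ 1` on `G` (unitary matrices in the operator norm).
[cite: Balaban1985Averaging, (19) p.21] -/
theorem norm_conj_eq {G : Subgroup 𝔸ˣ} (hG1 : ∀ g ∈ G, ‖(g : 𝔸)‖ ≤ 1) {g : 𝔸ˣ} (hg : g ∈ G) (X : 𝔸) :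
    ‖(g : 𝔸) * X * ↑g⁻¹‖ = ‖X‖ := by
  refine le_antisymm (B8CurlGradHolonomy.norm_conj_le g X (hG1 g hg) (hG1 g⁻¹ (G.inv_mem hg))) ?_
  have h := B8CurlGradHolonomy.norm_conj_le g⁻¹ ((g : 𝔸) * X * ↑g⁻¹) (hG1 g⁻¹ (G.inv_mem hg))
    (by rw [inv_inv]; exact hG1 g hg)
  rw [inv_inv] at h
  simpa only [mul_assoc, Units.inv_mul_cancel_left, Units.inv_mul, mul_one] using h

omit [NormedAlgebra ℂ 𝔸] [CompleteSpace 𝔸] in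
/-- `‖gXg⁻¹ − 1‖ = ‖X − 1‖` for such `g` (the plaquette bounds (1.11), (1.14) are gauge invariant). [cite: Balaban1987RG1, (1.11) p.262] -/
theorem norm_conj_sub_one_eq {G : Subgroup 𝔸ˣ} (hG1 : ∀ g ∈ G, ‖(g : 𝔸)‖ ≤ 1) {g : 𝔸ˣ} (hg : g ∈ G) (X : 𝔸) :
    ‖(g : 𝔸) * X * ↑g⁻¹ - 1‖ = ‖X - 1‖ := by
  have h : (g : 𝔸) * X * ↑g⁻¹ - 1 = (g : 𝔸) * (X - 1) * ↑g⁻¹ := by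
    rw [mul_sub, sub_mul, mul_one, Units.mul_inv]
  rw [h, norm_conj_eq hG1 hg]

/-- `v · exp iξA · v⁻¹ = exp iξ(vAv⁻¹)` («R(U)X = UXU⁻¹» commutes with the exponential; `B12Membership314.exp_units_conj'`).
[cite: Balaban1987RG1, (1.13) p.262] -/
theorem conj_expI (v : 𝔸ˣ) (ξ : ℝ) (a : 𝔸) : v * expI ξ a * v⁻¹ = expI ξ ((v : 𝔸) * a * ↑v⁻¹) := by
  ext
  have h : (I * (ξ : ℂ)) • ((v : 𝔸) * a * ↑v⁻¹) = (v : 𝔸) * ((I * (ξ : ℂ)) • a) * ↑v⁻¹ := by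
    rw [mul_smul_comm, smul_mul_assoc]
  simp only [Units.val_mul, expI, Beta.BackgroundVertices.val_expUnit]
  rw [h, B12Membership314.exp_units_conj']

omit [CompleteSpace 𝔸] in
/-- **Gauge covariance of the covariant derivative**: `∇^ξ_{𝐔^v, μ}(R(v)A′)_ν(x) = v(x)·(∇^ξ_{𝐔,μ}A′_ν)(x)·v(x)⁻¹`
([Balaban1985BackgroundPropagators] (3.3) in the `ξ`-scale). [cite: Balaban1987RG1, (1.13) p.262] -/
theorem nabla_gaugeU_adJ (ξ : ℝ) (v : Site P i → 𝔸ˣ) (U : PBond P i → 𝔸ˣ) (μ ν : Fin P.d) (A : PBond P i → 𝔸)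
    (x : Site P i) :
    nabla ξ (gaugeU v U) μ (fun y => adJ v A ⟨y, ν⟩) x =
      (v x : 𝔸) * nabla ξ U μ (fun y => A ⟨y, ν⟩) x * ↑(v x)⁻¹ := by
  simp only [nabla, gaugeU, adJ, PBond.tgt, mul_smul_comm, smul_mul_assoc]
  congr 1
  simp only [mul_inv_rev, inv_inv, Units.val_mul, mul_sub, sub_mul, mul_assoc, Units.inv_mul_cancel_left]

/-! ## §2. The conditions (i)–(iv) under `G`-valued gauge transformations -/

/-- **(i) is `G`-invariant**: `U ↦ U^v` for `G`-valued `v` preserves (1.11) (isometry) and (1.12) (local gauge `u ↦ uv⁻¹`, the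
same `A`). [cite: Balaban1987RG1, (1.11)-(1.12) p.262] -/
theorem condI_gaugeU (hG1 : ∀ g ∈ 𝓜.G, ‖(g : 𝔸)‖ ≤ 1) {F : Frame P i 𝔸} {c : StepConsts} {α₀ : ℝ}
    {U : PBond P i → 𝔸ˣ} {v : Site P i → 𝔸ˣ} (hv : ∀ x, v x ∈ 𝓜.G) (h : CondI 𝓜 F c α₀ U) :
    CondI 𝓜 F c α₀ (gaugeU v U) := by
  refine ⟨fun b hb => 𝓜.G.mul_mem (𝓜.G.mul_mem (hv _) (h.gValued b hb)) (𝓜.G.inv_mem (hv _)), fun p hp => ?_,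
    fun C hC => ?_⟩
  · rw [plaq_gaugeU, Units.val_mul, Units.val_mul, norm_conj_sub_one_eq hG1 (hv p.src)]
    exact h.plaq_lt p hp
  · obtain ⟨u, hu, A, hgauge, hA, hdA⟩ := h.localGauge C hC
    refine ⟨u * v⁻¹, fun x => 𝓜.G.mul_mem (hu x) (by rw [Pi.inv_apply]; exact 𝓜.G.inv_mem (hv x)), A, ?_, hA, hdA⟩
    intro b hb
    rw [← gaugeU_mul, inv_mul_cancel_right]
    exact hgauge b hb

omit [CompleteSpace 𝔸] in
/-- **(ii) is `G`-invariant**: `(U, A′) ↦ (U^v, R(v)A′)` preserves (1.13) (for `Ad(G)`-stable `𝔤ᶜ`).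
[cite: Balaban1987RG1, (1.13) p.262] -/
theorem condII_act (hG1 : ∀ g ∈ 𝓜.G, ‖(g : 𝔸)‖ ≤ 1) (hgc : ∀ g ∈ 𝓜.G, ∀ X ∈ 𝓜.gc, (g : 𝔸) * X * ↑g⁻¹ ∈ 𝓜.gc)
    {X : Region P i} {c : StepConsts} {α₁ : ℝ} {U : PBond P i → 𝔸ˣ} {A' : PBond P i → 𝔸} {v : Site P i → 𝔸ˣ}
    (hv : ∀ x, v x ∈ 𝓜.G) (h : CondII 𝓜 X c α₁ U A') : CondII 𝓜 X c α₁ (gaugeU v U) (adJ v A') := by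
  refine ⟨fun b hb => hgc _ (hv _) _ (h.gcValued b hb), fun b hb => ?_, fun q hq => ?_⟩
  · show ‖(v b.src : 𝔸) * A' b * ↑(v b.src)⁻¹‖ < α₁
    rw [norm_conj_eq hG1 (hv _)]
    exact h.norm_lt b hb
  · rw [nabla_gaugeU_adJ, norm_conj_eq hG1 (hv _)]
    exact h.nabla_lt q hq

omit [NormedAlgebra ℂ 𝔸] [CompleteSpace 𝔸] in
/-- **(iii) is `G`-invariant**: `(𝐔, 𝐉) ↦ (𝐔^v, R(v)𝐉)` preserves (1.14). [cite: Balaban1987RG1, (1.14) p.262] -/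
theorem condIII_act {G : Subgroup 𝔸ˣ} (hG1 : ∀ g ∈ G, ‖(g : 𝔸)‖ ≤ 1) {X : Region P i} {c : StepConsts} {α₀ γ₀ : ℝ}
    {Uc : PBond P i → 𝔸ˣ} {Jc : PBond P i → 𝔸} {v : Site P i → 𝔸ˣ} (hv : ∀ x, v x ∈ G)
    (h : CondIII X c α₀ γ₀ Uc Jc) : CondIII X c α₀ γ₀ (gaugeU v Uc) (adJ v Jc) := by
  refine ⟨fun p hp => ?_, fun b hb => ?_⟩
  · rw [plaq_gaugeU, Units.val_mul, Units.val_mul, norm_conj_sub_one_eq hG1 (hv p.src)]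
    exact h.plaq_lt p hp
  · show ‖(v b.src : 𝔸) * Jc b * ↑(v b.src)⁻¹‖ < γ₀
    rw [norm_conj_eq hG1 (hv _)]
    exact h.J_lt b hb

/-- The factorisation transforms as `𝐔^v = (exp iξR(v)A′)·U^v`. [cite: Balaban1987RG1, (1.11) p.262] -/
theorem factors_act {c : StepConsts} {Uc U : PBond P i → 𝔸ˣ} {A' : PBond P i → 𝔸} (v : Site P i → 𝔸ˣ)
    (h : Factors c Uc U A') : Factors c (gaugeU v Uc) (gaugeU v U) (adJ v A') := by
  intro b
  show v b.src * Uc b * (v b.tgt)⁻¹ = expI c.ξ ((v b.src : 𝔸) * A' b * ↑(v b.src)⁻¹) * (v b.src * U b * (v b.tgt)⁻¹)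
  rw [← conj_expI, h b]
  simp only [mul_assoc, inv_mul_cancel_left]

omit [NormedAlgebra ℂ 𝔸] [CompleteSpace 𝔸] in
/-- **(iv) under the covariance of its data**: if the functions `U_n(M˙(·))` are gauge COVARIANT (`U_n(M˙(V^v)) = U_n(M˙(V))^w` for
some `G`-valued `w`) and the norms of `J_n(M˙(·))` are gauge invariant — in print properties of the constructions of [14, 15], here
hypotheses on the data — then (1.16) for `V` implies (1.16) for `V^v`. [cite: Balaban1987RG1, (1.15)-(1.16) p.262] -/
theorem condIV_gaugeU {G : Subgroup 𝔸ˣ} (hG1 : ∀ g ∈ G, ‖(g : 𝔸)‖ ≤ 1) {bg : BackgroundFns P i 𝔸} {X₂ : Region P i}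
    {c : StepConsts} {α₀ : ℝ} {V : PBond P i → 𝔸ˣ} {v : Site P i → 𝔸ˣ}
    (hUn : ∀ n, ∃ w : Site P i → 𝔸ˣ, (∀ x, w x ∈ G) ∧ bg.Un n (gaugeU v V) = gaugeU w (bg.Un n V))
    (hJn : ∀ n b, ‖bg.Jn n (gaugeU v V) b‖ = ‖bg.Jn n V b‖) (h : CondIV bg X₂ c α₀ V) :
    CondIV bg X₂ c α₀ (gaugeU v V) := by
  refine ⟨fun n hn hnj p hp => ?_, fun n hn hnj b hb => ?_⟩
  · obtain ⟨w, hw, hwn⟩ := hUn n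
    rw [hwn, plaq_gaugeU, Units.val_mul, Units.val_mul, norm_conj_sub_one_eq hG1 (hw p.src)]
    exact h.plaq_lt n hn hnj p hp
  · rw [hJn]
    exact h.J_lt n hn hnj b hb

/-- **«(𝐔, 𝐉) satisfy (i)–(iii)» is invariant under `G`-valued gauge transformations** (same constants): the transformed pair
factorises with `U ↦ U^v ∈ G`, `A′ ↦ R(v)A′ ∈ 𝔤ᶜ`, and (1.11)–(1.14) are preserved (hypotheses: `‖·‖ ≤ 1` on `G`, `G ≤ Gᶜ`,
`𝔤ᶜ` `Ad(G)`-stable). [cite: Balaban1987RG1, (3.29) p.276] -/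
theorem satisfiesI_III_act (hG1 : ∀ g ∈ 𝓜.G, ‖(g : 𝔸)‖ ≤ 1) (hGc : 𝓜.G ≤ 𝓜.Gc)
    (hgc : ∀ g ∈ 𝓜.G, ∀ X ∈ 𝓜.gc, (g : 𝔸) * X * ↑g⁻¹ ∈ 𝓜.gc) {F : Frame P i 𝔸} {c : StepConsts} {α₀ α₁ γ₀ : ℝ}
    {Φ : FieldPair P i 𝔸ˣ 𝔸} {v : Site P i → 𝔸ˣ} (hv : ∀ x, v x ∈ 𝓜.G) (h : SatisfiesI_III 𝓜 F c α₀ α₁ γ₀ Φ) :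
    SatisfiesI_III 𝓜 F c α₀ α₁ γ₀ (act v Φ) := by
  obtain ⟨hG, hg, U, A', hf, h1, h2, h3⟩ := h
  refine ⟨fun b hb => ?_, fun b hb => hgc _ (hv _) _ (hg b hb), gaugeU v U, adJ v A', factors_act v hf,
    condI_gaugeU hG1 hv h1, condII_act hG1 hgc hv h2, condIII_act hG1 hv h3⟩
  exact 𝓜.Gc.mul_mem (𝓜.Gc.mul_mem (hGc (hv _)) (hG b hb)) (𝓜.Gc.inv_mem (hGc (hv _)))

/-- The same as an equivalence (apply the forward direction to `v⁻¹`). [cite: Balaban1987RG1, (3.29) p.276] -/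
theorem satisfiesI_III_act_iff (hG1 : ∀ g ∈ 𝓜.G, ‖(g : 𝔸)‖ ≤ 1) (hGc : 𝓜.G ≤ 𝓜.Gc)
    (hgc : ∀ g ∈ 𝓜.G, ∀ X ∈ 𝓜.gc, (g : 𝔸) * X * ↑g⁻¹ ∈ 𝓜.gc) {F : Frame P i 𝔸} {c : StepConsts} {α₀ α₁ γ₀ : ℝ}
    (Φ : FieldPair P i 𝔸ˣ 𝔸) {v : Site P i → 𝔸ˣ} (hv : ∀ x, v x ∈ 𝓜.G) :
    SatisfiesI_III 𝓜 F c α₀ α₁ γ₀ (act v Φ) ↔ SatisfiesI_III 𝓜 F c α₀ α₁ γ₀ Φ := by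
  refine ⟨fun h => ?_, satisfiesI_III_act hG1 hGc hgc hv⟩
  have hv' : ∀ x, v⁻¹ x ∈ 𝓜.G := fun x => by
    rw [Pi.inv_apply]
    exact 𝓜.G.inv_mem (hv x)
  simpa only [act_inv_act] using satisfiesI_III_act hG1 hGc hgc hv' h

/-- **«(𝐔, 𝐉) satisfy (i)–(iv)» is invariant under `G`-valued gauge transformations**, given the gauge covariance of the data of
(iv) at `𝐔` and at the factor `U` («and the same bounds hold for U instead of 𝐔»). [cite: Balaban1987RG1, (1.19) p.263] -/
theorem satisfies_act (hG1 : ∀ g ∈ 𝓜.G, ‖(g : 𝔸)‖ ≤ 1) (hGc : 𝓜.G ≤ 𝓜.Gc)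
    (hgc : ∀ g ∈ 𝓜.G, ∀ X ∈ 𝓜.gc, (g : 𝔸) * X * ↑g⁻¹ ∈ 𝓜.gc) {F : Frame P i 𝔸} {c : StepConsts} {α₀ α₁ γ₀ : ℝ}
    {Φ : FieldPair P i 𝔸ˣ 𝔸} {v : Site P i → 𝔸ˣ} (hv : ∀ x, v x ∈ 𝓜.G)
    (hUn : ∀ (V : PBond P i → 𝔸ˣ) (n : ℕ), ∃ w : Site P i → 𝔸ˣ, (∀ x, w x ∈ 𝓜.G) ∧
      F.bg.Un n (gaugeU v V) = gaugeU w (F.bg.Un n V))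
    (hJn : ∀ (V : PBond P i → 𝔸ˣ) (n : ℕ) (b : PBond P i), ‖F.bg.Jn n (gaugeU v V) b‖ = ‖F.bg.Jn n V b‖)
    (h : Satisfies 𝓜 F c α₀ α₁ γ₀ Φ) : Satisfies 𝓜 F c α₀ α₁ γ₀ (act v Φ) := by
  obtain ⟨hG, hg, U, A', hf, h1, h2, h3, h4, h5⟩ := h
  refine ⟨fun b hb => ?_, fun b hb => hgc _ (hv _) _ (hg b hb), gaugeU v U, adJ v A', factors_act v hf,
    condI_gaugeU hG1 hv h1, condII_act hG1 hgc hv h2, condIII_act hG1 hv h3,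
    condIV_gaugeU hG1 (hUn Φ.U) (hJn Φ.U) h4, condIV_gaugeU hG1 (hUn U) (hJn U) h5⟩
  exact 𝓜.Gc.mul_mem (𝓜.Gc.mul_mem (hGc (hv _)) (hG b hb)) (𝓜.Gc.inv_mem (hGc (hv _)))

/-! ## §3. (3.16) is invariant under `G`-valued gauge transformations -/

/-- **(3.16) is `G`-gauge invariant**: its first member `U^c_j(X, ½α₀, ½α₁, α₀)` is a union of orbits (invariant even under
`Gᶜ`-valued `u`, `B12RegularSpaces111.act_mem_space_iff`), its second member by `satisfiesI_III_act_iff` — (3.29) for `G`-valued `u`.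
[cite: Balaban1987RG1, (3.29) p.276] -/
theorem act_mem_space316_iff (hG1 : ∀ g ∈ 𝓜.G, ‖(g : 𝔸)‖ ≤ 1) (hGc : 𝓜.G ≤ 𝓜.Gc)
    (hgc : ∀ g ∈ 𝓜.G, ∀ X ∈ 𝓜.gc, (g : 𝔸) * X * ↑g⁻¹ ∈ 𝓜.gc) {Fj : Frame P i 𝔸} {cj : StepConsts} {Fk : Frame P i 𝔸}
    {ck : StepConsts} {β α₀ α₁ : ℝ} (Φ : FieldPair P i 𝔸ˣ 𝔸) {v : Site P i → 𝔸ˣ} (hv : ∀ x, v x ∈ 𝓜.G) :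
    act v Φ ∈ space316 𝓜 Fj cj Fk ck β α₀ α₁ ↔ Φ ∈ space316 𝓜 Fj cj Fk ck β α₀ α₁ := by
  show act v Φ ∈ space 𝓜 Fj cj (α₀ / 2) (α₁ / 2) α₀ ∧ SatisfiesI_III 𝓜 Fk ck ((1 + β) * α₀) ((1 + β) * α₁) α₀ (act v Φ) ↔
    Φ ∈ space 𝓜 Fj cj (α₀ / 2) (α₁ / 2) α₀ ∧ SatisfiesI_III 𝓜 Fk ck ((1 + β) * α₀) ((1 + β) * α₁) α₀ Φ
  rw [act_mem_space_iff Φ fun x => hGc (hv x), satisfiesI_III_act_iff hG1 hGc hgc Φ hv]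

end Normed

end

end Literature.MathematicalPhysics.QuantumFieldTheory.Balaban1983to89.B12RegularSpaces111Gauge
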